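import Summits.CriticalPhenomena.PercolationContinuityZ3.Theorems.PercNearOneGluingNoHeavyLowerTailThreePointHubGraphs
import HarnessLib

/-!
# The square-root laws `(SQ₃)` / `(SQ)` are FALSE: the hub graph `K_{3,59}` at weight `½`

Support file for crux `stmt-CriticalPhenomena-4575` (`NoHeavyLowerTail`), lead seat `prim-nh-lead-4575` gen 129
(`--supports stmt-CriticalPhenomena-4575`).  No definitions, no sorries, standard axioms.  Counterexample found by `prim-sahi-census`
g29 (CENSUS §87 ADDENDUM 4, 2026-08-24), re-derived independently by `prim-sahi-lit` g64 (LIT §80.7) and by the lead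
(INEQ-CLAIMS l.3883–3886; engines `run/shared/lean/prim/prim-nh-lead-4575/lab-gen129/sq3/`).

The lead's gen-128 rows (INEQ-CLAIMS l.3872–3881; kernel `…SuperTerminalQuarticOfSqrtLaw`, whose HYPOTHESIS is `(SQ)`):
* `(SQ)`  `μ(F ∩ c∤T)² ≤ μ(F)²·μ(c∤T)`, `F = (s↔a) ∩ (s↔b)ᶜ`, `T = {s,a,b}`;
* `(SQ₃)` (its case `a = s`): `μ(s|b|c)² ≤ μ(c∤{s,b})·μ(s↮b)²`, i.e. `P(c∤{s,b} | s↮b) ≤ √P(c∤{s,b})`.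
Both hold on every weighted graph with `≤ 6` vertices (exact tensor-Bernstein certificates, lead gen 128) and FAIL on the hub graph
`K_{3,k}` (terminals `s, b, c` each joined to `k` hubs by pairs of weight `½`, nothing else) as soon as `k ≥ 59`:
by the product formulas of `…ThreePointHubGraphs` (`isoA_eq`, `isoB_eq`, `isoC_eq`, `sep_eq`), `μ(s|b|c) = 2^{-k}`,
`μ(c∤{s,b}) = μ(s∤{b,c}) = μ(b∤{s,c}) = (5/8)^k` and `μ(s↮b) = μ(s∤{b,c}) + μ(b∤{s,c}) − μ(s|b|c) = 2(5/8)^k − 2^{-k}`, so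
`μ(s|b|c)² / (μ(c∤{s,b})·μ(s↮b)²) → ¼·(128/125)^k`; at `k = 59` the ratio is `1.01306…`.

The weight function is described by ONE hypothesis `hw` (pairs joining a terminal `0, 1, 2` of `Fin 62` (`0 = s`, `1 = b`, `2 = c`) to a hub have weight `½`,
all other pairs weight `0`); `exists_khubWeight` provides it.
* `real_sep_khub`, `real_isoS_khub`, `real_isoB_khub`, `real_isoC_khub`, `real_disconn_khub` — the four probabilities;
* `sqrtLaw₃_fails` — `μ(c∤{s,b})·μ(s↮b)² < μ(s|b|c)²` under `hw` (`s = 0`, `b = 1`, `c = 2`); `exists_sqrtLaw₃_fails`;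
* `not_sqrtLaw₃`, `not_sqrtLaw` — hence neither `(SQ₃)` nor the hypothesis `(SQ)` of
  `SuperTerminalQuarticOfSqrtLaw.superTerminalQuartic_of_sqrtLaw` holds for all finite weighted graphs (the implication
  `(SQ) ⟹ V4` of that file is untouched; `V4` itself holds on `K_{3,k}` for every `k`).
-/

namespace Summit.CriticalPhenomena.PercolationContinuityZ3.Theorems.SqrtLawFails

open MeasureTheory Set
open Literature.Probability.Percolation Literature.Probability.LatticeModels
open Summit.CriticalPhenomena.PercolationContinuityZ3.Theorems.ThreePointHubEvents
open Summit.CriticalPhenomena.PercolationContinuityZ3.Theorems.ThreePointHubGraphs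

/-! ## The weight function of `K_{3,59}` on `Fin 62`, as a hypothesis -/

/-- **A weight function of `K_{3,59}` exists**: `½` on terminal–hub pairs, `0` on all other pairs (terminals `0,1,2` of `Fin 62`).
[this work] -/
theorem exists_khubWeight : ∃ w : Sym2 (Fin 62) → unitInterval,
    ∀ u v : Fin 62, (w s(u, v) : ℝ) = if (u ∈ ({0, 1, 2} : Finset (Fin 62)) ↔ v ∈ ({0, 1, 2} : Finset (Fin 62))) then 0 else 1 / 2 := by
  have hsymm : ∀ u v : Fin 62,
      (fun u v : Fin 62 => if (u ∈ ({0, 1, 2} : Finset (Fin 62)) ↔ v ∈ ({0, 1, 2} : Finset (Fin 62))) then (⟨0, le_rfl, zero_le_one⟩ : unitInterval)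
        else ⟨1 / 2, by norm_num, by norm_num⟩) u v =
      (fun u v : Fin 62 => if (u ∈ ({0, 1, 2} : Finset (Fin 62)) ↔ v ∈ ({0, 1, 2} : Finset (Fin 62))) then (⟨0, le_rfl, zero_le_one⟩ : unitInterval)
        else ⟨1 / 2, by norm_num, by norm_num⟩) v u := by
    intro u v
    by_cases hu : u ∈ ({0, 1, 2} : Finset (Fin 62)) <;> by_cases hv : v ∈ ({0, 1, 2} : Finset (Fin 62)) <;> simp [hu, hv]
  refine ⟨Sym2.lift ⟨_, hsymm⟩, fun u v => ?_⟩
  rw [Sym2.lift_mk]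
  dsimp only
  split_ifs <;> rfl

section khub
variable (w : Sym2 (Fin 62) → unitInterval)
  (hw : ∀ u v : Fin 62, (w s(u, v) : ℝ) = if (u ∈ ({0, 1, 2} : Finset (Fin 62)) ↔ v ∈ ({0, 1, 2} : Finset (Fin 62))) then 0 else 1 / 2)
include hw

/-- Terminal–hub pairs have weight `½`. [this work] -/
theorem coe_w_term_hub {t h : Fin 62} (ht : t ∈ ({0, 1, 2} : Finset (Fin 62))) (hh : h ∉ ({0, 1, 2} : Finset (Fin 62))) : (w s(t, h) : ℝ) = 1 / 2 := by
  rw [hw, if_neg (fun e => hh (e.1 ht))]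

/-- Pairs of two terminals, or of two hubs, have weight `0`. [this work] -/
theorem coe_w_same {u v : Fin 62} (huv : u ∈ ({0, 1, 2} : Finset (Fin 62)) ↔ v ∈ ({0, 1, 2} : Finset (Fin 62))) : (w s(u, v) : ℝ) = 0 := by
  rw [hw, if_pos huv]

omit hw in
/-- Hubs are not terminals. [this work] -/
theorem not_mem_of_mem_hubs {h : Fin 62} (hh : h ∈ hubs (0 : Fin 62) 1 2) : h ∉ ({0, 1, 2} : Finset (Fin 62)) := by
  rw [mem_hubs] at hh
  intro e
  simp only [Finset.mem_insert, Finset.mem_singleton] at e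
  rcases e with e | e | e
  · exact hh.1 e
  · exact hh.2.1 e
  · exact hh.2.2 e

omit hw in
/-- `K_{3,59}` has `59` hubs. [this work] -/
theorem card_hubs : (hubs (0 : Fin 62) 1 2).card = 59 := by
  have e : hubs (0 : Fin 62) 1 2 = ((Finset.univ.erase 0).erase 1).erase 2 := by
    ext v
    simp only [mem_hubs, Finset.mem_erase, Finset.mem_univ, and_true]
    tauto
  have m0 : (0 : Fin 62) ∈ (Finset.univ : Finset (Fin 62)) := Finset.mem_univ _
  have m1 : (1 : Fin 62) ∈ (Finset.univ : Finset (Fin 62)).erase 0 :=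
    Finset.mem_erase.2 ⟨(by decide : (1 : Fin 62) ≠ 0), Finset.mem_univ _⟩
  have m2 : (2 : Fin 62) ∈ ((Finset.univ : Finset (Fin 62)).erase 0).erase 1 :=
    Finset.mem_erase.2 ⟨(by decide : (2 : Fin 62) ≠ 1), Finset.mem_erase.2 ⟨(by decide : (2 : Fin 62) ≠ 0), Finset.mem_univ _⟩⟩
  rw [e, Finset.card_erase_of_mem m2, Finset.card_erase_of_mem m1, Finset.card_erase_of_mem m0, Finset.card_univ,
    Fintype.card_fin]

/-- No hub–hub pair has positive weight, so the null event of `…ThreePointHubEvents` is null. [this work] -/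
theorem real_bad_khub : (prodBernoulli w).real (bad (0 : Fin 62) 1 2) = 0 :=
  real_bad w fun _ hu _ hv _ => coe_w_same w hw (iff_of_false (not_mem_of_mem_hubs hu) (not_mem_of_mem_hubs hv))

omit hw in
/-- `0 ≠ 1` in `Fin 62`. [folklore] -/
theorem ne01 : (0 : Fin 62) ≠ 1 := by decide
omit hw in
/-- `0 ≠ 2` in `Fin 62`. [folklore] -/
theorem ne02 : (0 : Fin 62) ≠ 2 := by decide
omit hw in
/-- `1 ≠ 2` in `Fin 62`. [folklore] -/
theorem ne12 : (1 : Fin 62) ≠ 2 := by decide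

omit hw in
/-- `0, 1, 2` are terminals. [this work] -/
theorem mem_T₃ : (0 : Fin 62) ∈ ({0, 1, 2} : Finset (Fin 62)) ∧ (1 : Fin 62) ∈ ({0, 1, 2} : Finset (Fin 62)) ∧ (2 : Fin 62) ∈ ({0, 1, 2} : Finset (Fin 62)) := by decide

/-- The three hub-pair weights at a hub are `½`. [this work] -/
theorem coe_w_hub {h : Fin 62} (hh : h ∈ hubs (0 : Fin 62) 1 2) :
    (w s(0, h) : ℝ) = 1 / 2 ∧ (w s(1, h) : ℝ) = 1 / 2 ∧ (w s(2, h) : ℝ) = 1 / 2 :=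
  ⟨coe_w_term_hub w hw mem_T₃.1 (not_mem_of_mem_hubs hh), coe_w_term_hub w hw mem_T₃.2.1 (not_mem_of_mem_hubs hh),
    coe_w_term_hub w hw mem_T₃.2.2 (not_mem_of_mem_hubs hh)⟩

/-! ## The four probabilities -/

/-- `μ(s|b|c) = 2^{-59}`. [this work] -/
theorem real_sep_khub :
    (prodBernoulli w).real ((((openConn (0 : Fin 62) 1)ᶜ ∩ (openConn 0 2)ᶜ) ∩ ((openConn 0 1)ᶜ ∩ (openConn 1 2)ᶜ)) :
      Set (BondConfig (Fin 62))) = (1 / 2 : ℝ) ^ 59 := by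
  rw [sep_eq w ne01 ne02 ne12 (real_bad_khub w hw), coe_w_same w hw (iff_of_true mem_T₃.1 mem_T₃.2.1),
    coe_w_same w hw (iff_of_true mem_T₃.1 mem_T₃.2.2), coe_w_same w hw (iff_of_true mem_T₃.2.1 mem_T₃.2.2)]
  rw [Finset.prod_congr rfl fun h hh => by
    rw [(coe_w_hub w hw hh).1, (coe_w_hub w hw hh).2.1, (coe_w_hub w hw hh).2.2]]
  rw [Finset.prod_const, card_hubs]
  norm_num

/-- `μ(s∤{b,c}) = (5/8)^{59}`. [this work] -/
theorem real_isoS_khub :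
    (prodBernoulli w).real (((openConn (0 : Fin 62) 1)ᶜ ∩ (openConn 0 2)ᶜ) : Set (BondConfig (Fin 62))) =
      (5 / 8 : ℝ) ^ 59 := by
  rw [isoA_eq w ne01 ne02 ne12 (real_bad_khub w hw), coe_w_same w hw (iff_of_true mem_T₃.1 mem_T₃.2.1),
    coe_w_same w hw (iff_of_true mem_T₃.1 mem_T₃.2.2)]
  rw [Finset.prod_congr rfl fun h hh => by
    rw [(coe_w_hub w hw hh).1, (coe_w_hub w hw hh).2.1, (coe_w_hub w hw hh).2.2]]
  rw [Finset.prod_const, card_hubs]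
  norm_num

/-- `μ(b∤{s,c}) = (5/8)^{59}`. [this work] -/
theorem real_isoB_khub :
    (prodBernoulli w).real (((openConn (0 : Fin 62) 1)ᶜ ∩ (openConn 1 2)ᶜ) : Set (BondConfig (Fin 62))) =
      (5 / 8 : ℝ) ^ 59 := by
  rw [isoB_eq w ne01 ne02 ne12 (real_bad_khub w hw), coe_w_same w hw (iff_of_true mem_T₃.1 mem_T₃.2.1),
    coe_w_same w hw (iff_of_true mem_T₃.2.1 mem_T₃.2.2)]
  rw [Finset.prod_congr rfl fun h hh => by
    rw [(coe_w_hub w hw hh).1, (coe_w_hub w hw hh).2.1, (coe_w_hub w hw hh).2.2]]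
  rw [Finset.prod_const, card_hubs]
  norm_num

/-- `μ(c∤{s,b}) = (5/8)^{59}`. [this work] -/
theorem real_isoC_khub :
    (prodBernoulli w).real (((openConn (0 : Fin 62) 2)ᶜ ∩ (openConn 1 2)ᶜ) : Set (BondConfig (Fin 62))) =
      (5 / 8 : ℝ) ^ 59 := by
  rw [isoC_eq w ne01 ne02 ne12 (real_bad_khub w hw), coe_w_same w hw (iff_of_true mem_T₃.1 mem_T₃.2.2),
    coe_w_same w hw (iff_of_true mem_T₃.2.1 mem_T₃.2.2)]
  rw [Finset.prod_congr rfl fun h hh => by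
    rw [(coe_w_hub w hw hh).1, (coe_w_hub w hw hh).2.1, (coe_w_hub w hw hh).2.2]]
  rw [Finset.prod_const, card_hubs]
  norm_num

omit hw in
/-- In any configuration, `s ↮ b` iff `s` is isolated from `{b,c}` or `b` is isolated from `{s,c}` (if `s ↔ c` and `c ↔ b` then
`s ↔ b`). [folklore] -/
theorem compl_openConn_eq_union {V : Type*} (s b c : V) :
    ((openConn s b)ᶜ : Set (BondConfig V)) =
      ((openConn s b)ᶜ ∩ (openConn s c)ᶜ) ∪ ((openConn s b)ᶜ ∩ (openConn b c)ᶜ) := by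
  ext ω
  simp only [mem_compl_iff, mem_union, mem_inter_iff]
  constructor
  · intro h
    by_cases hsc : ω ∈ openConn s c
    · refine Or.inr ⟨h, fun hbc => h ?_⟩
      change (openGraph ω).Reachable s b
      exact (show (openGraph ω).Reachable s c from hsc).trans (show (openGraph ω).Reachable b c from hbc).symm
    · exact Or.inl ⟨h, hsc⟩
  · rintro (⟨h, -⟩ | ⟨h, -⟩) <;> exact h

/-- `μ(s↮b) = 2·(5/8)^{59} − 2^{-59}` on `K_{3,59}` (inclusion–exclusion). [this work] -/
theorem real_disconn_khub :
    (prodBernoulli w).real ((openConn (0 : Fin 62) 1)ᶜ : Set (BondConfig (Fin 62))) =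
      2 * (5 / 8 : ℝ) ^ 59 - (1 / 2 : ℝ) ^ 59 := by
  rw [compl_openConn_eq_union (0 : Fin 62) 1 2]
  have h := measureReal_union_add_inter (μ := prodBernoulli w)
    (s := (((openConn (0 : Fin 62) 1)ᶜ ∩ (openConn 0 2)ᶜ) : Set (BondConfig (Fin 62))))
    (t := (((openConn (0 : Fin 62) 1)ᶜ ∩ (openConn 1 2)ᶜ) : Set (BondConfig (Fin 62)))) MeasurableSet.of_discrete
  rw [real_isoS_khub w hw, real_isoB_khub w hw, real_sep_khub w hw] at h
  linarith

/-! ## The refutation -/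

/-- **`(SQ₃)` fails on `K_{3,59}` at weight `½`**: `μ(c∤{s,b}) · μ(s↮b)² < μ(s|b|c)²` for `s = 0`, `b = 1`, `c = 2`
(numerically `(5/8)^59 · (2(5/8)^59 − 2^{-59})² < 4^{-59}`, ratio `1.01306…`).  First found by prim-sahi-census (§87 add. 4).
[this work] -/
theorem sqrtLaw₃_fails :
    (prodBernoulli w).real (((openConn (0 : Fin 62) 2)ᶜ ∩ (openConn 1 2)ᶜ) : Set (BondConfig (Fin 62))) *
        (prodBernoulli w).real ((openConn (0 : Fin 62) 1)ᶜ : Set (BondConfig (Fin 62))) ^ 2 <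
      (prodBernoulli w).real ((((openConn (0 : Fin 62) 1)ᶜ ∩ (openConn 0 2)ᶜ) ∩ ((openConn 0 1)ᶜ ∩ (openConn 1 2)ᶜ)) :
        Set (BondConfig (Fin 62))) ^ 2 := by
  rw [real_isoC_khub w hw, real_disconn_khub w hw, real_sep_khub w hw]
  norm_num

end khub

/-- **There is a finite weighted graph on which `(SQ₃)` fails** (`K_{3,59}` at weight `½`; terminals `0, 1`, port `2`). [this work] -/
theorem exists_sqrtLaw₃_fails : ∃ w : Sym2 (Fin 62) → unitInterval,
    (prodBernoulli w).real (((openConn (0 : Fin 62) 2)ᶜ ∩ (openConn 1 2)ᶜ) : Set (BondConfig (Fin 62))) *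
        (prodBernoulli w).real ((openConn (0 : Fin 62) 1)ᶜ : Set (BondConfig (Fin 62))) ^ 2 <
      (prodBernoulli w).real ((((openConn (0 : Fin 62) 1)ᶜ ∩ (openConn 0 2)ᶜ) ∩ ((openConn 0 1)ᶜ ∩ (openConn 1 2)ᶜ)) :
        Set (BondConfig (Fin 62))) ^ 2 := by
  obtain ⟨w, hw⟩ := exists_khubWeight
  exact ⟨w, sqrtLaw₃_fails w hw⟩

/-- **`(SQ₃)` is not a theorem**: it is false that for every finite weighted graph and all `s b c`,
`μ(s|b|c)² ≤ μ(c∤{s,b})·μ(s↮b)²`. [this work] -/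
theorem not_sqrtLaw₃ :
    ¬ ∀ (V : Type) [Fintype V] (w : Sym2 V → unitInterval) (s b c : V),
      (prodBernoulli w).real ((((openConn s b)ᶜ ∩ (openConn s c)ᶜ) ∩ ((openConn s b)ᶜ ∩ (openConn b c)ᶜ)) : Set (BondConfig V)) ^ 2 ≤
        (prodBernoulli w).real (((openConn s c)ᶜ ∩ (openConn b c)ᶜ) : Set (BondConfig V)) *
          (prodBernoulli w).real ((openConn s b)ᶜ : Set (BondConfig V)) ^ 2 := by
  intro h
  obtain ⟨w, hw⟩ := exists_sqrtLaw₃_fails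
  exact absurd (h (Fin 62) w 0 1 2) (not_le.2 hw)

/-- **The hypothesis `(SQ)` of `SuperTerminalQuarticOfSqrtLaw.superTerminalQuartic_of_sqrtLaw` is not a theorem**: with `a = s`
it is `(SQ₃)`, which fails on `K_{3,59}`.  (The implication `(SQ) ⟹ V4` proved there is untouched.) [this work] -/
theorem not_sqrtLaw :
    ¬ ∀ (V : Type) [Fintype V] (w : Sym2 V → unitInterval) (s a b c : V),
      (prodBernoulli w).real (openConn s a ∩ (openConn s b)ᶜ ∩ ((openConn c s)ᶜ ∩ (openConn c a)ᶜ ∩ (openConn c b)ᶜ) :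
          Set (BondConfig V)) ^ 2 ≤
        (prodBernoulli w).real (openConn s a ∩ (openConn s b)ᶜ : Set (BondConfig V)) ^ 2 *
          (prodBernoulli w).real ((openConn c s)ᶜ ∩ (openConn c a)ᶜ ∩ (openConn c b)ᶜ : Set (BondConfig V)) := by
  intro h
  obtain ⟨w, hw⟩ := exists_sqrtLaw₃_fails
  have h1 := h (Fin 62) w 0 0 1 2
  have hself : (openConn (0 : Fin 62) 0 : Set (BondConfig (Fin 62))) = univ :=
    eq_univ_of_forall fun ω => (SimpleGraph.Reachable.refl (G := openGraph ω) 0)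
  have hsymm : ∀ x y : Fin 62, (openConn x y : Set (BondConfig (Fin 62))) = openConn y x := fun x y => by
    ext ω; exact ⟨fun h => SimpleGraph.Reachable.symm h, fun h => SimpleGraph.Reachable.symm h⟩
  rw [hself, univ_inter, hsymm 2 0, hsymm 2 1, inter_self] at h1
  have e : ((openConn (0 : Fin 62) 1)ᶜ ∩ ((openConn 0 2)ᶜ ∩ (openConn 1 2)ᶜ) : Set (BondConfig (Fin 62))) =
      ((openConn (0 : Fin 62) 1)ᶜ ∩ (openConn 0 2)ᶜ) ∩ ((openConn 0 1)ᶜ ∩ (openConn 1 2)ᶜ) := by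
    ext ω; simp only [mem_inter_iff, mem_compl_iff]; tauto
  rw [e, mul_comm] at h1
  exact absurd h1 (not_le.2 hw)

end Summit.CriticalPhenomena.PercolationContinuityZ3.Theorems.SqrtLawFails
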